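import Mathlib.Topology.MetricSpace.HausdorffDistance
import Mathlib.Analysis.Convex.Topology
import Literature.Probability.Percolation.BoxCrossing
import HarnessLib

/-!
# Towards `discreteCrossingProb_clusterPt_mem_Ioo`: discretisation lemmas (proved)

Topic: Probability / Percolation. Companion ("Proofs") file of
`Literature/Probability/Percolation/BoxCrossing.lean`, collecting the elementary, fully proved
steps of the folklore RSW corollary `Literature.Probability.Percolation.discreteCrossingProb_clusterPt_mem_Ioo`
(subsequential limits of conformal-rectangle crossing probabilities at `p = 1/2` lie in `(0, 1)`;
Grimmett, *Probability on Graphs*, 2nd ed. (2018), §5.7 p. 176 and Exercise 5.6: "a standard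
application of the RSW method"). The probabilistic and planar-topological inputs are vendored
separately (`rsw_half`, `harris_fkg`, `Grimmett1999_openCircuitAround_half`,
`JordanCurveTheorem`); here we prove what needs no such input:

* the discrete domain `Ω_δ` is closed under mesh-graph neighbours among mesh vertices
  (`mem_meshDomain_of_meshGraph_adj`), so a discrete boundary vertex has a lattice edge that
  leaves `Ω` or `Ω̄`, hence a point of `∂Ω` within `|δ|` (`exists_mem_frontier_of_mem_meshBoundary`,
  `infDist_frontier_le_of_mem_meshBoundary`);
* a vertex of the discrete arc of `A ⊆ ∂Ω` is within `|δ|` of `A` (`infDist_le_of_mem_discreteArc`);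
* the arcs `(ab)` and `(cd)` of a conformal rectangle are disjoint compact sets at positive
  distance (`MarkedDomain.disjoint_arc_zero_arc_two`, `MarkedDomain.exists_pos_forall_lt_dist_arc`,
  stated for `R : ConformalRectangle = MarkedDomain 4`), so
  for small mesh their discrete arcs are disjoint (`discreteArc_inter_eq_empty_of_lt`) — ruling
  out the trivial one-vertex "crossing";
* crossing probabilities lie in `[0, 1]`, so do their cluster points
  (`mem_Icc_of_mapClusterPt_discreteCrossingProb`), and the target fact follows from uniform
  two-sided bounds for small mesh (`discreteCrossingProb_clusterPt_mem_Ioo_of_bounds`), which is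
  the form in which the RSW/FKG argument delivers it.

Mathlib anchors: `Metric.infDist`, `IsCompact.exists_infDist_eq_dist`,
`IsPreconnected.subset_of_closure_inter_subset` (a segment leaving an open set meets its
frontier), `Metric.exists_pos_forall_lt_edist`, `IsClosed.mem_of_mapClusterPt`, `Filter.Eventually`.

## References
* G. Grimmett, *Percolation*, 2nd ed. (1999), §11.7 [GrimmettPercolation1999].
* G. Grimmett, *Probability on Graphs*, 2nd ed. (2018), §5.7, Ex. 5.6.
* S. Smirnov, C. R. Acad. Sci. Paris 333 (2001) 239–244, §2 [Smirnov2001].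
-/

namespace Literature.Probability.Percolation

open MeasureTheory Filter Topology Metric Set LatticeModels

noncomputable section

/-! ### Mesh geometry -/

/-- Adjacent sites of `ℤ²` have mesh points at distance `|δ|`. [folklore] -/
theorem dist_meshPoint_of_adj {δ : ℝ} {x y : Site 2} (h : (zdGraph 2).Adj x y) :
    dist (meshPoint δ x) (meshPoint δ y) = |δ| := by
  have key : ∀ (u : Site 2) (i : Fin 2),
      dist (meshPoint δ u) (meshPoint δ (u + Pi.single i 1)) = |δ| := by
    intro u i
    rw [Complex.dist_eq]
    have hre : (meshPoint δ u - meshPoint δ (u + Pi.single i 1)).re =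
        -(δ * (Pi.single (M := fun _ : Fin 2 => ℤ) i (1 : ℤ) 0 : ℤ)) := by
      simp only [Complex.sub_re, meshPoint_re, Pi.add_apply, Int.cast_add]; ring
    have him : (meshPoint δ u - meshPoint δ (u + Pi.single i 1)).im =
        -(δ * (Pi.single (M := fun _ : Fin 2 => ℤ) i (1 : ℤ) 1 : ℤ)) := by
      simp only [Complex.sub_im, meshPoint_im, Pi.add_apply, Int.cast_add]; ring
    rw [← Complex.re_add_im (meshPoint δ u - meshPoint δ (u + Pi.single i 1)), hre, him]
    fin_cases i
    · simp [Complex.norm_real]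
    · simp
  obtain ⟨i, rfl | rfl⟩ := (zdGraph_adj_iff x y).1 h
  · exact key x i
  · rw [dist_comm]; exact key y i

/-- The discrete domain `Ω_δ` (a union of whole connected components of the mesh graph on mesh
vertices) is closed under mesh-graph neighbours that are mesh vertices. [folklore] -/
theorem mem_meshDomain_of_meshGraph_adj {Ω : Set ℂ} {δ : ℝ} {x y : Site 2}
    (hx : x ∈ meshDomain Ω δ) (hy : y ∈ meshVertices Ω δ) (hxy : (meshGraph Ω δ).Adj x y) :
    y ∈ meshDomain Ω δ := by
  simp only [meshDomain, mem_iUnion, mem_image] at hx ⊢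
  obtain ⟨C, hC, x', hx'C, rfl⟩ := hx
  refine ⟨C, hC, ⟨y, hy⟩, ?_, rfl⟩
  rw [SimpleGraph.ConnectedComponent.mem_supp_iff] at hx'C ⊢
  rw [← hx'C]
  exact SimpleGraph.ConnectedComponent.sound
    (SimpleGraph.Adj.reachable (show (meshVertexGraph Ω δ).Adj ⟨y, hy⟩ x' from hxy.symm))

/-- A segment starting inside an open set `Ω` but not contained in it meets `∂Ω`. [folklore] -/
theorem exists_mem_segment_frontier {Ω : Set ℂ} (hΩ : IsOpen Ω) {a b : ℂ} (ha : a ∈ Ω)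
    (h : ¬ segment ℝ a b ⊆ Ω) : ∃ w ∈ segment ℝ a b, w ∈ frontier Ω := by
  by_contra! hcon
  refine h ((convex_segment a b).isPreconnected.subset_of_closure_inter_subset hΩ
    ⟨a, left_mem_segment ℝ a b, ha⟩ ?_)
  rintro w ⟨hwc, hws⟩
  by_contra hw
  exact hcon w hws ⟨hwc, by rwa [hΩ.interior_eq]⟩

/-- A discrete boundary vertex `x ∈ ∂Ω_δ` of an open set `Ω` has a lattice neighbour `y` such
that the closed mesh edge `[δx, δy]` meets `∂Ω`: either `δy ∉ Ω`, or the edge leaves `Ω̄`.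
(Smirnov 2001, §2: boundary vertices of the discretised domain.) [cite: Smirnov2001, §2] -/
theorem exists_mem_frontier_of_mem_meshBoundary {Ω : Set ℂ} (hΩ : IsOpen Ω) {δ : ℝ} {x : Site 2}
    (hx : x ∈ meshBoundary Ω δ) :
    ∃ y, (zdGraph 2).Adj x y ∧
      ∃ w ∈ segment ℝ (meshPoint δ x) (meshPoint δ y), w ∈ frontier Ω := by
  obtain ⟨hxD, y, hxy, hy⟩ := mem_meshBoundary_iff'.1 hx
  have hxΩ : meshPoint δ x ∈ Ω := meshDomain_subset_meshVertices Ω δ hxD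
  refine ⟨y, hxy, exists_mem_segment_frontier hΩ hxΩ fun hseg => ?_⟩
  have hadj : (meshGraph Ω δ).Adj x y :=
    meshGraph_adj_iff.2 ⟨hxy, hseg.trans subset_closure⟩
  rcases hy with hy | hy
  · exact hy (mem_meshDomain_of_meshGraph_adj hxD (hseg (right_mem_segment ℝ _ _)) hadj)
  · exact hy hadj

/-- A discrete boundary vertex of an open set `Ω` lies within `|δ|` of `∂Ω`.
(Smirnov 2001, §2.) [cite: Smirnov2001, §2] -/
theorem infDist_frontier_le_of_mem_meshBoundary {Ω : Set ℂ} (hΩ : IsOpen Ω) {δ : ℝ} {x : Site 2}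
    (hx : x ∈ meshBoundary Ω δ) : infDist (meshPoint δ x) (frontier Ω) ≤ |δ| := by
  obtain ⟨y, hxy, w, hw, hwf⟩ := exists_mem_frontier_of_mem_meshBoundary hΩ hx
  refine (infDist_le_dist_of_mem hwf).trans ?_
  have hsub : segment ℝ (meshPoint δ x) (meshPoint δ y) ⊆ closedBall (meshPoint δ x) |δ| :=
    (convex_closedBall _ _).segment_subset (mem_closedBall_self (abs_nonneg δ))
      (by rw [mem_closedBall, dist_comm, dist_meshPoint_of_adj hxy])
  have := hsub hw
  rwa [mem_closedBall, dist_comm] at this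

/-- The frontier of an open set with a discrete boundary vertex is nonempty. [folklore] -/
theorem frontier_nonempty_of_mem_meshBoundary {Ω : Set ℂ} (hΩ : IsOpen Ω) {δ : ℝ} {x : Site 2}
    (hx : x ∈ meshBoundary Ω δ) : (frontier Ω).Nonempty := by
  obtain ⟨-, -, w, -, hwf⟩ := exists_mem_frontier_of_mem_meshBoundary hΩ hx
  exact ⟨w, hwf⟩

/-- A vertex of the discrete arc of `A ⊆ ∂Ω` is at least as close to `A` as to all of `∂Ω`
(it is closer to `A` than to `∂Ω \ A` by definition). [folklore] -/
theorem infDist_le_infDist_frontier_of_mem_discreteArc {Ω : Set ℂ} (hΩ : IsOpen Ω) {δ : ℝ}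
    {A : Set ℂ} {x : Site 2} (hx : x ∈ discreteArc Ω δ A) :
    infDist (meshPoint δ x) A ≤ infDist (meshPoint δ x) (frontier Ω) := by
  obtain ⟨hxb, hle⟩ := mem_discreteArc_iff.1 hx
  refine (le_infDist (frontier_nonempty_of_mem_meshBoundary hΩ hxb)).2 fun w hw => ?_
  by_cases hwA : w ∈ A
  · exact infDist_le_dist_of_mem hwA
  · exact hle.trans (infDist_le_dist_of_mem ⟨hw, hwA⟩)

/-- A vertex of the discrete arc of `A ⊆ ∂Ω` (for `Ω` open) lies within `|δ|` of `A`.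
(Smirnov 2001, §2: "the discrete arc is the set of boundary vertices closest to the arc".) [cite: Smirnov2001, §2] -/
theorem infDist_le_of_mem_discreteArc {Ω : Set ℂ} (hΩ : IsOpen Ω) {δ : ℝ} {A : Set ℂ}
    {x : Site 2} (hx : x ∈ discreteArc Ω δ A) : infDist (meshPoint δ x) A ≤ |δ| :=
  (infDist_le_infDist_frontier_of_mem_discreteArc hΩ hx).trans
    (infDist_frontier_le_of_mem_meshBoundary hΩ hx.1)

/-! ### The arcs `(ab)` and `(cd)` of a conformal rectangle -/

/-- For a conformal rectangle `(D; a, b, c, d)` the arc `(ab) = arc 0` is the image of the parameter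
interval `[mark 0, mark 1]`. [folklore] -/
theorem _root_.Literature.Probability.RandomPlanarGeometry.MarkedDomain.nextMark_zero (R : RandomPlanarGeometry.ConformalRectangle) : R.nextMark 0 = R.mark 1 := by
  simp [RandomPlanarGeometry.MarkedDomain.nextMark]

/-- For a conformal rectangle `(D; a, b, c, d)` the arc `(cd) = arc 2` is the image of the parameter
interval `[mark 2, mark 3]`. [folklore] -/
theorem _root_.Literature.Probability.RandomPlanarGeometry.MarkedDomain.nextMark_two (R : RandomPlanarGeometry.ConformalRectangle) : R.nextMark 2 = R.mark 3 := by
  simp [RandomPlanarGeometry.MarkedDomain.nextMark]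

/-- The opposite arcs `(ab)` and `(cd)` of a conformal rectangle are disjoint: their parameter
intervals `[m₀, m₁]` and `[m₂, m₃]` are disjoint subsets of the period `[0, 1)` on which the
boundary loop is injective (Smirnov 2001, §2: non-degenerate conformal rectangle). [cite: Smirnov2001, §2] -/
theorem _root_.Literature.Probability.RandomPlanarGeometry.MarkedDomain.disjoint_arc_zero_arc_two (R : RandomPlanarGeometry.ConformalRectangle) :
    Disjoint (R.arc 0) (R.arc 2) := by
  rw [Set.disjoint_left]
  rintro _ ⟨t, ht, rfl⟩ ⟨s, hs, hst⟩
  rw [R.nextMark_zero] at ht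
  rw [R.nextMark_two] at hs
  have h01 : R.mark 1 < R.mark 2 := R.strictMono_mark (by decide)
  have htI : t ∈ Ico (0 : ℝ) 1 := ⟨(R.mark_mem 0).1.trans ht.1, ht.2.trans_lt (R.mark_mem 1).2⟩
  have hsI : s ∈ Ico (0 : ℝ) 1 := ⟨(R.mark_mem 2).1.trans hs.1, hs.2.trans_lt (R.mark_mem 3).2⟩
  have := R.injOn_boundary hsI htI hst
  subst this
  linarith [hs.1, ht.2]

/-- The opposite arcs `(ab)` and `(cd)` of a conformal rectangle are at positive distance
(disjoint compact sets). [folklore] -/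
theorem _root_.Literature.Probability.RandomPlanarGeometry.MarkedDomain.exists_pos_forall_lt_dist_arc (R : RandomPlanarGeometry.ConformalRectangle) :
    ∃ ε : ℝ, 0 < ε ∧ ∀ a ∈ R.arc 0, ∀ b ∈ R.arc 2, ε < dist a b := by
  obtain ⟨r, hr, h⟩ := Metric.exists_pos_forall_lt_edist (R.isCompact_arc 0) (R.isClosed_arc 2)
    R.disjoint_arc_zero_arc_two
  refine ⟨r, by exact_mod_cast hr, fun a ha b hb => ?_⟩
  have := h a ha b hb
  rwa [edist_dist, ← ENNReal.ofReal_coe_nnreal,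
    ENNReal.ofReal_lt_ofReal_iff_of_nonneg (NNReal.coe_nonneg r)] at this

/-- **No trivial crossings for small mesh.** If `2|δ|` is smaller than the distance between the
arcs `(ab)` and `(cd)`, their discrete arcs in `Ω_δ` are disjoint: a common vertex would be within
`|δ|` of both arcs. (Smirnov 2001, §2.) [cite: Smirnov2001, §2] -/
theorem discreteArc_inter_eq_empty_of_lt (R : RandomPlanarGeometry.ConformalRectangle) {ε δ : ℝ}
    (hε : ∀ a ∈ R.arc 0, ∀ b ∈ R.arc 2, ε < dist a b) (hδ : 2 * |δ| ≤ ε) :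
    discreteArc R.carrier δ (R.arc 0) ∩ discreteArc R.carrier δ (R.arc 2) = ∅ := by
  rw [Set.eq_empty_iff_forall_notMem]
  rintro x ⟨hx0, hx2⟩
  have h0 := infDist_le_of_mem_discreteArc R.isOpen hx0
  have h2 := infDist_le_of_mem_discreteArc R.isOpen hx2
  obtain ⟨a, ha, hda⟩ := (R.isCompact_arc 0).exists_infDist_eq_dist ⟨_, R.pt_mem_arc_self 0⟩
    (meshPoint δ x)
  obtain ⟨b, hb, hdb⟩ := (R.isCompact_arc 2).exists_infDist_eq_dist ⟨_, R.pt_mem_arc_self 2⟩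
    (meshPoint δ x)
  have hab := hε a ha b hb
  have htri := dist_triangle_left a b (meshPoint δ x)
  rw [← hda, ← hdb] at htri
  linarith

/-- For every conformal rectangle there is `δ₀ > 0` such that for all meshes `0 < δ < δ₀` the
discrete arcs of `(ab)` and `(cd)` are disjoint. [folklore] -/
theorem eventually_discreteArc_inter_eq_empty (R : RandomPlanarGeometry.ConformalRectangle) :
    ∃ δ₀ : ℝ, 0 < δ₀ ∧ ∀ δ : ℝ, 0 < δ → δ < δ₀ →
      discreteArc R.carrier δ (R.arc 0) ∩ discreteArc R.carrier δ (R.arc 2) = ∅ := by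
  obtain ⟨ε, hε, h⟩ := R.exists_pos_forall_lt_dist_arc
  refine ⟨ε / 2, by positivity, fun δ hδ hδε => discreteArc_inter_eq_empty_of_lt R h ?_⟩
  rw [abs_of_pos hδ]
  linarith

/-! ### Cluster points of crossing probabilities -/

/-- Crossing probabilities of conformal rectangles lie in `[0, 1]`. [folklore] -/
theorem discreteCrossingProb_mem_Icc (p : unitInterval) (Ω : Set ℂ) (δ : ℝ) (A B : Set ℂ) :
    discreteCrossingProb p Ω δ A B ∈ Icc (0 : ℝ) 1 :=
  ⟨measureReal_nonneg, measureReal_le_one⟩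

/-- Every subsequential limit as `δ → 0⁺` of conformal-rectangle crossing probabilities lies in
`[0, 1]` (the trivial half of `discreteCrossingProb_clusterPt_mem_Ioo`). [folklore] -/
theorem mem_Icc_of_mapClusterPt_discreteCrossingProb (R : RandomPlanarGeometry.ConformalRectangle) {c : ℝ}
    (hc : MapClusterPt c (𝓝[>] 0) fun δ =>
      discreteCrossingProb half R.carrier δ (R.arc 0) (R.arc 2)) :
    c ∈ Icc (0 : ℝ) 1 :=
  isClosed_Icc.mem_of_mapClusterPt hc
    (Filter.Eventually.of_forall fun δ => discreteCrossingProb_mem_Icc _ _ δ _ _)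

/-- **Reduction to uniform bounds.** `discreteCrossingProb_clusterPt_mem_Ioo` follows as soon as,
for every conformal rectangle, the crossing probability is squeezed between two constants of
`(0, 1)` for all sufficiently small meshes — the form in which the RSW/FKG argument (Grimmett
2018, §5.7; Smirnov 2001, §2) delivers it. [folklore] -/
theorem discreteCrossingProb_clusterPt_mem_Ioo_of_bounds
    (h : ∀ R : RandomPlanarGeometry.ConformalRectangle, ∃ c₁ c₂ δ₀ : ℝ, 0 < c₁ ∧ c₂ < 1 ∧ 0 < δ₀ ∧
      ∀ δ : ℝ, 0 < δ → δ < δ₀ →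
        c₁ ≤ discreteCrossingProb half R.carrier δ (R.arc 0) (R.arc 2) ∧
          discreteCrossingProb half R.carrier δ (R.arc 0) (R.arc 2) ≤ c₂) :
    discreteCrossingProb_clusterPt_mem_Ioo := by
  intro R c hc
  obtain ⟨c₁, c₂, δ₀, hc₁, hc₂, hδ₀, hb⟩ := h R
  have hev : ∀ᶠ δ in 𝓝[>] (0 : ℝ),
      discreteCrossingProb half R.carrier δ (R.arc 0) (R.arc 2) ∈ Icc c₁ c₂ := by
    filter_upwards [Ioo_mem_nhdsGT hδ₀] with δ hδ
    exact hb δ hδ.1 hδ.2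
  have := isClosed_Icc.mem_of_mapClusterPt hc hev
  exact ⟨hc₁.trans_le this.1, this.2.trans_lt hc₂⟩

end

end Literature.Probability.Percolation
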